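import Summits.RiemannHypothesis.RiemannHypothesis.Theorems.Splittings.LiDifferenceOrderLawFdiff
import HarnessLib

/-!
# The DIFFERENCE-ORDER LAW — RH branch: every order `K ≥ 2` is two-signed with a margin in every window (SketchG7 §5b)

Cell rh-split, seat rh-split-li-bridge g7 (brief sha16 f79c5f09d8bcb036), card `run/shared/lean/pub/rh-split/cards/SPLIT-li-bridge.md` §14
(referee rh-split-ref g5: REPLAY PASS of v1 353a9a80816aea0e + v2 ca059ef508c1d3b5, 08:37:53Z; labels L1–L4 there); kernel source
`HOME/rh-split-li-bridge/SketchG7.lean` sha16 dac2b83ce457a730 (1546 l; = v2 + §5e `not_tendsto_liSecondDiff/_liFdiff` + 28 one-line docstrings,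
no decl text changed).  Cut by the seat (lead RULING #60, lane (xi-g)) into SIX tree modules at the scratch's section boundaries, decl text
byte-verbatim; deltas = namespace `RhSplit.LiBridgeG7` ↦ `…Theorems.Splittings.{LiWindowComplex, LiCurvatureSignChanges, LiDifferenceOrderLaw}`
(+ `open` of the earlier namespaces of the chain), module docstrings, and the variable-free wrapper `section HigherOrder … end HigherOrder`
dropped.  END-TO-END statement of the chain (last file): `LiDifferenceOrderLaw.liFdiff_signs_syndetic (hK : 2 ≤ K) :
∃ η > 0, ∃ L, ∀ N, (∃ n ∈ Ico N (N+L), fdiff K keiperLiCoeff n ≤ −η) ∧ (∃ n ∈ Ico N (N+L), η ≤ fdiff K keiperLiCoeff n)` — every forward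
difference of order `K ≥ 2` of Li's coefficients (K = 2: the curvature `d_n = λ_{n+2} − 2λ_{n+1} + λ_n`, file `LiCurvatureSignChanges`) takes
BOTH signs with a margin on a syndetic set, UNCONDITIONALLY (proof by cases on `RiemannHypothesis`; an RH-free kernel theorem about `λ_n`
alone, referee label L1; certifies nothing about RH; class (li, bridge) unchanged).

This file: §5b RH branch at order `K ≥ 2`: box sums `bsum`, coefficients `coefK K ρ = −m(ρ)(u_ρ − 1)^K` (`‖coefK K ρ‖ = m(ρ)/‖ρ‖^K`, conj-symmetric, resonance
sign-coherent), mass bound `cmassK_le` (needs `K ≥ 2`: order 1 has mass `Σ m/|ρ| = ∞`), uniform tail `abs_liFdiff_sub_ctrigSum_le`, and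
`liFdiff_two_signs_of_rh (hRH : RH) (hK : 2 ≤ K)` (RH-IMPLIED kernel estimate, label L2).

HONEST LABEL: «SPLITTING SEARCH over kernel-typed RH-EQUIVALENCES; a splitting A ∧ B ⟹ RH is CONDITIONAL bookkeeping unless A and B are
both proved; nothing here bears on the truth of RH.»
-/

set_option linter.dupNamespace false

noncomputable section

namespace Summit.RiemannHypothesis.RiemannHypothesis.Theorems.Splittings.LiDifferenceOrderLaw

open Complex Filter Topology Finset
open scoped Real ComplexConjugate
open Literature.NumberTheory.LFunctions
open Summit.RiemannHypothesis.RiemannHypothesis.Theorems.Splittings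
open Summit.RiemannHypothesis.RiemannHypothesis.Theorems.Splittings.LiIndexSets
open Summit.RiemannHypothesis.RiemannHypothesis.Theorems.Splittings.LiExtremalLayer
open Summit.RiemannHypothesis.RiemannHypothesis.Theorems.Splittings.LiSecondOrderCriterion
open Summit.RiemannHypothesis.RiemannHypothesis.Theorems.Splittings.LiWindowComplex
open Summit.RiemannHypothesis.RiemannHypothesis.Theorems.Splittings.LiCurvatureSignChanges

/-! ### §5b RH: every order `K ≥ 2` is two-signed with a margin in every window -/

/-- the tree's box partial sum `Λ_n(T) = Σ_{ρ ∈ box T} m(ρ)(1 − u_ρⁿ)` -/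
def bsum (T : ℝ) (n : ℕ) : ℂ :=
  ∑ ρ ∈ (liZeroBox_finite T).toFinset, (riemannZetaZeroOrder ρ : ℂ) * (1 - (1 - 1 / ρ) ^ n)

/-- The box sum `bsum T n` tends to `λ_n` as `T → ∞` (`n ≥ 1`; the tree's `tendsto_boxSum`). -/
theorem tendsto_bsum {n : ℕ} (hn : 1 ≤ n) : Tendsto (fun T ↦ bsum T n) atTop (𝓝 (keiperLiCoeff n : ℂ)) :=
  tendsto_boxSum hn

/-- Under RH the coefficient mass of `box T` is `2 Re (bsum T 1)` (restates `cmass_box`). -/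
theorem cmass_box' (hRH : RiemannHypothesis) (T : ℝ) : cmass (box T) coef = 2 * (bsum T 1).re :=
  cmass_box hRH T

/-- `Re (bsum T 1) ≤ λ₁` (the tree's `re_boxSum_one_le`). -/
theorem re_bsum_one_le (T : ℝ) : (bsum T 1).re ≤ keiperLiCoeff 1 := re_boxSum_one_le T

/-- `Re (bsum T 1) → λ₁` as `T → ∞` (the tree's `tendsto_re_boxSum_one`). -/
theorem tendsto_re_bsum_one : Tendsto (fun T : ℝ ↦ (bsum T 1).re) atTop (𝓝 (keiperLiCoeff 1)) :=
  tendsto_re_boxSum_one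

/-- the order-`K` coefficient `c_ρ^{(K)} = −m(ρ)(u_ρ − 1)^K = −m(ρ)(−1/ρ)^K` -/
def coefK (K : ℕ) (ρ : ℂ) : ℂ := -(riemannZetaZeroOrder ρ : ℂ) * (unitZ ρ - 1) ^ K

/-- `u_ρ − 1 = −1/ρ`. -/
theorem unitZ_sub_one (ρ : ℂ) : unitZ ρ - 1 = -(1 / ρ) := by
  rw [unitZ]
  ring

/-- `‖coefK K ρ‖ = m(ρ)/‖ρ‖^K` (for `m(ρ) ≥ 0`). -/
theorem norm_coefK {K : ℕ} {ρ : ℂ} (hm : (0 : ℝ) ≤ riemannZetaZeroOrder ρ) :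
    ‖coefK K ρ‖ = (riemannZetaZeroOrder ρ : ℝ) / ‖ρ‖ ^ K := by
  rw [coefK, unitZ_sub_one, norm_mul, norm_neg, Complex.norm_intCast, abs_of_nonneg hm, norm_pow, norm_neg,
    norm_div, norm_one, div_pow, one_pow, mul_one_div]

/-- order 2 of §5 is the curvature coefficient of §2 -/
theorem coefK_two (ρ : ℂ) : coefK 2 ρ = coef ρ := by
  rw [coefK, coef, unitZ_sub_one]
  ring

/-- `coefK K (conj ρ) = conj (coefK K ρ)` (multiplicities are conjugation-symmetric). -/
theorem coefK_conj (K : ℕ) (ρ : ℂ) : coefK K (conj ρ) = conj (coefK K ρ) := by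
  simp only [coefK, unitZ, map_neg, map_mul, map_pow, map_sub, map_one, map_div₀, map_intCast]
  rw [riemannZetaZeroOrder_conj_holds ρ]

/-- `coefK K ρ ≠ 0` for `ρ ∈ box T`. -/
theorem coefK_ne_zero (K : ℕ) {T : ℝ} {ρ : ℂ} (hρ : ρ ∈ box T) : coefK K ρ ≠ 0 := by
  obtain ⟨hρ0, hm, -, -, -⟩ := box_aux hρ
  rw [coefK, unitZ_sub_one]
  refine mul_ne_zero (neg_ne_zero.2 (by exact_mod_cast hm.ne')) (pow_ne_zero _ ?_)
  rw [neg_ne_zero, one_div]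
  exact inv_ne_zero hρ0

/-- under RH a resonance `u_ρ u_ρ' = 1` forces `ρ' = ρ̄` -/
theorem eq_conj_of_unitZ_mul_eq_one (hRH : RiemannHypothesis) {T T' : ℝ} {ρ ρ' : ℂ} (hρ : ρ ∈ box T)
    (hρ' : ρ' ∈ box T') (h : unitZ ρ * unitZ ρ' = 1) : ρ' = conj ρ := by
  obtain ⟨hρ0, -, -, -, -⟩ := box_aux hρ
  obtain ⟨hρ0', -, -, -, -⟩ := box_aux hρ'
  obtain ⟨-, -, h1ρ⟩ := box_rh hRH hρ
  have e1 : (1 : ℂ) - 1 / ρ = (ρ - 1) / ρ := by field_simp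
  have e2 : (1 : ℂ) - 1 / ρ' = (ρ' - 1) / ρ' := by field_simp
  have key : (ρ - 1) * (ρ' - 1) = ρ * ρ' := by
    have h' : (ρ - 1) / ρ * ((ρ' - 1) / ρ') = 1 := by rw [← e1, ← e2]; exact h
    rw [div_mul_div_comm, div_eq_one_iff_eq (mul_ne_zero hρ0 hρ0')] at h'
    exact h'
  rw [← h1ρ]
  linear_combination -key

/-- Under RH the order-`K` coefficients are sign-coherent on resonant pairs `u_ρ u_ρ' = 1`. -/
theorem box_hresK (hRH : RiemannHypothesis) (K : ℕ) (T : ℝ) :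
    ∀ ρ ∈ box T, ∀ ρ' ∈ box T, unitZ ρ * unitZ ρ' = 1 → 0 ≤ (coefK K ρ * coefK K ρ').re := by
  intro ρ hρ ρ' hρ' h
  rw [eq_conj_of_unitZ_mul_eq_one hRH hρ hρ' h, coefK_conj, Complex.mul_conj, Complex.ofReal_re]
  exact Complex.normSq_nonneg _

/-- The order-`K` coefficients are sign-coherent on equal frequencies `u_ρ = u_ρ'`. -/
theorem box_hresK' (K : ℕ) (T : ℝ) :
    ∀ ρ ∈ box T, ∀ ρ' ∈ box T, unitZ ρ = unitZ ρ' → 0 ≤ (coefK K ρ * conj (coefK K ρ')).re := by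
  intro ρ _ ρ' _ h
  have : ρ = ρ' := by
    rw [unitZ, unitZ, sub_right_inj, one_div, one_div, inv_inj] at h
    exact h
  rw [← this, Complex.mul_conj, Complex.ofReal_re]
  exact Complex.normSq_nonneg _

/-- The order-`K` mean square `csqMass (box T) (coefK K)` is monotone in `T`. -/
theorem csqMassK_mono (K : ℕ) {T T' : ℝ} (h : T ≤ T') :
    csqMass (box T) (coefK K) ≤ csqMass (box T') (coefK K) :=
  Finset.sum_le_sum_of_subset_of_nonneg (box_mono h) fun _ _ _ ↦ sq_nonneg _

/-- The order-`K` mean square of a nonempty box is positive. -/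
theorem csqMassK_pos (K : ℕ) {T : ℝ} (hT : (box T).Nonempty) : 0 < csqMass (box T) (coefK K) :=
  Finset.sum_pos (fun _ hρ ↦ pow_pos (norm_pos_iff.2 (coefK_ne_zero K hρ)) 2) hT

/-- a box zero outside the unit box has `|ρ| ≥ |Im ρ| > 1` -/
theorem one_le_norm_of_not_mem_box {T : ℝ} {ρ : ℂ} (hρ : ρ ∈ box T) (h1 : ρ ∉ box 1) : 1 ≤ ‖ρ‖ := by
  rw [mem_box] at hρ h1
  obtain ⟨hz, h0, h1', him, -⟩ := hρ
  have : ¬ |ρ.im| ≤ 1 := fun h ↦ h1 ⟨hz, h0, h1', him, h⟩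
  exact (le_of_lt (not_le.1 this)).trans (Complex.abs_im_le_norm ρ)

/-- for `|ρ| ≥ 1` the order-`K` coefficient (`K ≥ 2`) is dominated by the curvature coefficient -/
theorem norm_coefK_le_norm_coef {K : ℕ} (hK : 2 ≤ K) {ρ : ℂ} (hm : (0 : ℝ) ≤ riemannZetaZeroOrder ρ)
    (h1 : 1 ≤ ‖ρ‖) : ‖coefK K ρ‖ ≤ ‖coef ρ‖ := by
  rw [norm_coefK hm, norm_coef hm]
  exact div_le_div_of_nonneg_left hm (pow_pos (lt_of_lt_of_le one_pos h1) 2) (pow_le_pow_right₀ h1 hK)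

/-- uniform mass bound: `M_T^{(K)} ≤ M_1^{(K)} + 2λ₁` for `T ≥ 1`, `K ≥ 2` (no zero-free input needed) -/
theorem cmassK_le (hRH : RiemannHypothesis) {K : ℕ} (hK : 2 ≤ K) {T : ℝ} (hT : 1 ≤ T) :
    cmass (box T) (coefK K) ≤ cmass (box 1) (coefK K) + 2 * keiperLiCoeff 1 := by
  classical
  have hsub : box 1 ⊆ box T := box_mono hT
  have key : ∑ ρ ∈ box T \ box 1, ‖coefK K ρ‖ ≤ 2 * keiperLiCoeff 1 :=
    calc ∑ ρ ∈ box T \ box 1, ‖coefK K ρ‖ ≤ ∑ ρ ∈ box T \ box 1, ‖coef ρ‖ := by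
          refine Finset.sum_le_sum fun ρ hρ ↦ ?_
          rw [Finset.mem_sdiff] at hρ
          exact norm_coefK_le_norm_coef hK (box_aux hρ.1).2.1.le (one_le_norm_of_not_mem_box hρ.1 hρ.2)
      _ ≤ ∑ ρ ∈ box T, ‖coef ρ‖ :=
          Finset.sum_le_sum_of_subset_of_nonneg Finset.sdiff_subset fun _ _ _ ↦ norm_nonneg _
      _ ≤ 2 * keiperLiCoeff 1 := cmass_box_le hRH T
  rw [cmass, cmass, ← Finset.sum_sdiff hsub]
  linarith

/-- the order-`K+1` difference of the box sums is the linear model with coefficients `c^{(K+1)}` -/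
theorem fdiff_bsum (K : ℕ) (T : ℝ) (N : ℕ) :
    fdiff (K + 1) (bsum T) N = ∑ ρ ∈ box T, coefK (K + 1) ρ * unitZ ρ ^ N := by
  rw [show bsum T = fun n ↦ ∑ ρ ∈ box T, (riemannZetaZeroOrder ρ : ℂ) * (1 - unitZ ρ ^ n) from rfl,
    fdiff_sum]
  refine Finset.sum_congr rfl fun ρ _ ↦ ?_
  have e : (fun m ↦ (riemannZetaZeroOrder ρ : ℂ) * (1 - unitZ ρ ^ m))
      = fun m ↦ (riemannZetaZeroOrder ρ : ℂ) + (-(riemannZetaZeroOrder ρ : ℂ)) * unitZ ρ ^ m := by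
    funext m
    ring
  rw [e, fdiff_add, fdiff_const, fdiff_geom, zero_add, coefK]

/-- `Re (Δ^{K+1} (bsum T)) N` is the complex trigonometric sum of `box T` with coefficients `coefK (K+1)`. -/
theorem re_fdiff_bsum (K : ℕ) (T : ℝ) (N : ℕ) :
    (fdiff (K + 1) (bsum T) N).re = ctrigSum (box T) (coefK (K + 1)) unitZ N := by
  rw [fdiff_bsum, Complex.re_sum, ctrigSum]

/-- `Δ^K Λ_·(T)(N+1) → Δ^K λ (N+1)` as `T → ∞` -/
theorem tendsto_fdiff_bsum (K N : ℕ) :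
    Tendsto (fun T ↦ fdiff K (bsum T) (N + 1)) atTop (𝓝 ((fdiff K keiperLiCoeff (N + 1) : ℝ) : ℂ)) := by
  have h := tendsto_fdiff K (fun T m ↦ bsum T (m + 1)) (fun m ↦ (keiperLiCoeff (m + 1) : ℂ))
    (fun m ↦ tendsto_bsum (by omega)) N
  have e1 : ∀ T, fdiff K (fun m ↦ bsum T (m + 1)) N = fdiff K (bsum T) (N + 1) :=
    fun T ↦ fdiff_shift K (bsum T) N
  have e2 : fdiff K (fun m ↦ (keiperLiCoeff (m + 1) : ℂ)) N = ((fdiff K keiperLiCoeff (N + 1) : ℝ) : ℂ) := by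
    rw [← fdiff_shift K keiperLiCoeff N, ← fdiff_ofReal]
  rw [e2] at h
  exact h.congr e1

/-- **Uniform tail bound, order `K ≥ 2`, under RH:** `|Δ^K λ_{N+1} − g_T^{(K)}(N+1)| ≤ 2(λ₁ − Re Λ₁(T))` for
every `T ≥ 1` (outside the box `|ρ| ≥ 1`, so `m/|ρ|^K ≤ m/|ρ|²`). -/
theorem abs_liFdiff_sub_ctrigSum_le (hRH : RiemannHypothesis) {K : ℕ} (hK : 2 ≤ K) {T : ℝ} (hT : 1 ≤ T)
    (N : ℕ) :
    |fdiff K keiperLiCoeff (N + 1) - ctrigSum (box T) (coefK K) unitZ (N + 1)|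
      ≤ 2 * (keiperLiCoeff 1 - (bsum T 1).re) := by
  classical
  obtain ⟨K', rfl⟩ : ∃ K', K = K' + 1 := ⟨K - 1, by omega⟩
  have hlim : Tendsto (fun T' : ℝ ↦ ctrigSum (box T') (coefK (K' + 1)) unitZ (N + 1)) atTop
      (𝓝 (fdiff (K' + 1) keiperLiCoeff (N + 1))) := by
    have h := (Complex.continuous_re.tendsto _).comp (tendsto_fdiff_bsum (K' + 1) N)
    rw [Complex.ofReal_re] at h
    refine h.congr fun T' ↦ ?_
    rw [Function.comp_apply, re_fdiff_bsum]
  have hev : ∀ᶠ T' in atTop,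
      |ctrigSum (box T') (coefK (K' + 1)) unitZ (N + 1) - ctrigSum (box T) (coefK (K' + 1)) unitZ (N + 1)|
        ≤ 2 * (keiperLiCoeff 1 - (bsum T 1).re) := by
    filter_upwards [eventually_ge_atTop T] with T' hT'
    have hsub : box T ⊆ box T' := box_mono hT'
    have hdiff : ctrigSum (box T') (coefK (K' + 1)) unitZ (N + 1) - ctrigSum (box T) (coefK (K' + 1)) unitZ (N + 1)
        = ∑ ρ ∈ box T' \ box T, (coefK (K' + 1) ρ * unitZ ρ ^ (N + 1)).re := by
      rw [ctrigSum, ctrigSum, ← Finset.sum_sdiff hsub, add_sub_cancel_right]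
    have hmass : ∑ ρ ∈ box T' \ box T, ‖coef ρ‖ = cmass (box T') coef - cmass (box T) coef := by
      rw [cmass, cmass, ← Finset.sum_sdiff hsub, add_sub_cancel_right]
    rw [hdiff]
    calc |∑ ρ ∈ box T' \ box T, (coefK (K' + 1) ρ * unitZ ρ ^ (N + 1)).re|
        ≤ ∑ ρ ∈ box T' \ box T, ‖coefK (K' + 1) ρ‖ := by
          refine (Finset.abs_sum_le_sum_abs _ _).trans (Finset.sum_le_sum fun ρ hρ ↦ ?_)
          have hρ' : ρ ∈ box T' := (Finset.mem_sdiff.1 hρ).1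
          refine (abs_re_le_norm _).trans ?_
          rw [norm_mul, norm_pow, (box_rh hRH hρ').2.1, one_pow, mul_one]
      _ ≤ ∑ ρ ∈ box T' \ box T, ‖coef ρ‖ := by
          refine Finset.sum_le_sum fun ρ hρ ↦ ?_
          rw [Finset.mem_sdiff] at hρ
          have h1 : ρ ∉ box 1 := fun h ↦ hρ.2 (box_mono hT h)
          exact norm_coefK_le_norm_coef hK (box_aux hρ.1).2.1.le (one_le_norm_of_not_mem_box hρ.1 h1)
      _ = cmass (box T') coef - cmass (box T) coef := hmass
      _ ≤ _ := by
          rw [cmass_box' hRH T', cmass_box' hRH T]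
          linarith [re_bsum_one_le T']
  exact le_of_tendsto ((hlim.sub_const _).abs) hev

/-- **RH branch, every order `K ≥ 2`.** Under RH there are `η > 0` and `L` such that every window
`[N, N+L)`, `N ≥ 1`, contains `n`, `n'` with `Δ^K λ_n ≥ η` and `Δ^K λ_{n'} ≤ −η`. -/
theorem liFdiff_two_signs_of_rh (hRH : RiemannHypothesis) {K : ℕ} (hK : 2 ≤ K) :
    ∃ η : ℝ, 0 < η ∧ ∃ L : ℕ, ∀ N : ℕ, 1 ≤ N →
      (∃ n ∈ Ico N (N + L), η ≤ fdiff K keiperLiCoeff n) ∧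
      (∃ n ∈ Ico N (N + L), fdiff K keiperLiCoeff n ≤ -η) := by
  obtain ⟨T₀', hT₀'⟩ := exists_box_nonempty hRH
  have hl : 0 < keiperLiCoeff 1 := by
    have := cmass_pos (csqMass_box_pos hT₀')
    linarith [cmass_box_le hRH T₀']
  set T₀ := max T₀' 1 with hT₀def
  have hT₀1 : 1 ≤ T₀ := le_max_right _ _
  have hne : (box T₀).Nonempty := hT₀'.mono (box_mono (le_max_left _ _))
  have hσ₀ : 0 < csqMass (box T₀) (coefK K) := csqMassK_pos K hne
  set B : ℝ := cmass (box 1) (coefK K) + 2 * keiperLiCoeff 1 with hBdef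
  have hB : 0 < B := by
    have h0 : 0 ≤ cmass (box 1) (coefK K) := Finset.sum_nonneg fun _ _ ↦ norm_nonneg _
    linarith
  have hB0 : B ≠ 0 := hB.ne'
  set η : ℝ := csqMass (box T₀) (coefK K) / (16 * B) with hηdef
  have hη : 0 < η := by positivity
  obtain ⟨T₁, hT₁⟩ := Metric.tendsto_atTop.1 tendsto_re_bsum_one (η / 2) (by positivity)
  set T := max T₀ T₁ with hTdef
  have hT1 : 1 ≤ T := hT₀1.trans (le_max_left _ _)
  have htail : 2 * (keiperLiCoeff 1 - (bsum T 1).re) ≤ η := by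
    have h := hT₁ T (le_max_right _ _)
    rw [Real.dist_eq] at h
    have := (abs_lt.1 h).1
    linarith
  have hσ : 0 < csqMass (box T) (coefK K) := csqMassK_pos K (hne.mono (box_mono (le_max_left _ _)))
  have hMT : 0 < cmass (box T) (coefK K) := cmass_pos hσ
  have hwin := cwindow_two_signs (box_hu hRH T) (box_hu1 T) (box_hresK hRH K T) (box_hresK' K T) hσ
  have hmargin : 2 * η ≤ cmargin (box T) (coefK K) := by
    have h1 : csqMass (box T₀) (coefK K) ≤ csqMass (box T) (coefK K) := csqMassK_mono K (le_max_left _ _)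
    have h2 : cmass (box T) (coefK K) ≤ B := cmassK_le hRH hK hT1
    rw [cmargin, hηdef, le_div_iff₀ (by positivity)]
    calc 2 * (csqMass (box T₀) (coefK K) / (16 * B)) * (8 * cmass (box T) (coefK K))
        = csqMass (box T₀) (coefK K) * (cmass (box T) (coefK K) / B) := by
          field_simp
          ring
      _ ≤ csqMass (box T) (coefK K) * 1 := by
          refine mul_le_mul h1 ?_ (by positivity) hσ.le
          rw [div_le_one hB]
          exact h2
      _ = csqMass (box T) (coefK K) := mul_one _
  refine ⟨η, hη, cwindowLen (box T) (coefK K) unitZ, fun N hN ↦ ⟨?_, ?_⟩⟩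
  · obtain ⟨n, hn, hge⟩ := (hwin N).1
    refine ⟨n, hn, ?_⟩
    obtain ⟨n', rfl⟩ : ∃ n', n = n' + 1 := Nat.exists_eq_add_of_le' (hN.trans (Finset.mem_Ico.1 hn).1)
    have h := abs_le.1 (abs_liFdiff_sub_ctrigSum_le hRH hK hT1 n')
    linarith [h.1, h.2]
  · obtain ⟨n, hn, hle⟩ := (hwin N).2
    refine ⟨n, hn, ?_⟩
    obtain ⟨n', rfl⟩ : ∃ n', n = n' + 1 := Nat.exists_eq_add_of_le' (hN.trans (Finset.mem_Ico.1 hn).1)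
    have h := abs_le.1 (abs_liFdiff_sub_ctrigSum_le hRH hK hT1 n')
    linarith [h.1, h.2]

end Summit.RiemannHypothesis.RiemannHypothesis.Theorems.Splittings.LiDifferenceOrderLaw

end
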